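import Mathlib
import HarnessLib
import Summits.AtomisticToContinuum.FouriersLaw.Theses.TangentFlowDephasing
import Summits.AtomisticToContinuum.FouriersLaw.Theorems.EmbeddedDrudeMourreGreenKuboContinuationHeatableInfrastructure

/-!
# Birth skeleton (BC3) for crux `TangentFlowDephasing.OnePhononL2Decay`
(item `stmt-AtomisticToContinuum-12157`, route `route-AtomisticToContinuum-TangentFlowDephasing`,
sub-problem `FouriersLaw`; registrar `planner-skel-stmt-AtomisticToContinuum-12157-0`, 2026-08-17)

Crux (FIXED, concluded BY NAME below) — SD1, the dephasing input, ∃-form: for `pinnedChain ω₂ lam β γ`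
(all `> 0`) and every `T > 0` there are a SHIFT-INVARIANT DLR Gibbs state `μ` and a `μ`-preserving
infinite-volume dynamics `D` with absolutely convergent current correlations at every time such
that the one-phonon block `G_ab(x,t) = ∫ a_0 · (b_x ∘ φ_t) dμ` (`a, b ∈ {q, p}`) has `μ`-integrable
integrands, `t ↦ F(x,t) := Σ_ab G_ab(x,t)²` is integrable on `(0,∞)` for each `x`, and
`x ↦ ∫_0^∞ F(x,t) dt` is summable (finite `L²` phonon lifetime, `∫∫ |Ĝ(k,t)|² dk dt < ∞`).

## Line `birth` — THE CANONICAL CARRIER + the k-INTEGRATED ONE-PHONON INTENSITY `K(t)`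

The ∃-frame is NOT a stub: it is the PROVED infrastructure `stub_heatableInfrastructure`
(`Theorems/EmbeddedDrudeMourreGreenKuboContinuationHeatableInfrastructure.lean`, sorry-free, landed for
crux 12597): ONE dynamics `D` with `D.carrier = bmGood` (the Buttà–Marchioro flow on its superstable
set) and, at every `T > 0`, a shift-invariant DLR Gibbs state `μ_T` preserved by `D` with absolutely
convergent current correlations (the shift-invariant DLR state is unique and superstable:
`eq_of_isChainGibbsMeasure_of_isShiftInvariant_pinnedChain`,
`hasSuperstabilityEstimate_of_isShiftInvariant_pinnedChain`).  All three stubs are therefore stated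
over THE canonical class `{D.carrier = bmGood, μ shift-invariant DLR at T, D.PreservesMeasure μ}` —
the physical dynamics in the physical thermal state, no exotic witness — and the line's object is the
k-integrated one-phonon intensity `K(t) := Σ_x F(x,t) = Σ_ab ∫_𝕋 |Ĝ_ab(k,t)|² dk`, handled through its
finite partial sums `Σ_{x∈s} F(x,t)` (junk-free: no `tsum`).

* `stub_onePhononRegularity` (CARRIER REGULARITY, provable now, size M): on the canonical class the
  four integrands `a_0 · (b_x ∘ φ_t)` are `μ`-integrable and the four functions `t ↦ G_ab(x,t)` are
  continuous.  Route: 4th moments of `q_0, p_0` under the superstable state, `MeasurePreserving (φ_t)`,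
  `InfiniteChainDynamics.integral_sq_mul_comp_le` / `continuous_integral_mul_comp_flow`
  (`Literature/…/InfiniteChainTwoPointContinuity.lean`) with `continuous_flow_apply`.  Supplies clause
  (ii) of the crux and the measurability behind (iii)–(iv).
* `stub_uniformIntensityBound` (STATIC INPUT × Koopman unitarity, provable with work, size L): there is
  `K₀` with `Σ_{x∈s} F(x,t) ≤ K₀` for every time `t` and finite `s ⊂ ℤ` — the k-space `L²` norm of the
  one-phonon block is bounded uniformly in time.  Mechanism: `G_ab(x,t) = ⟨a_0 ∘ φ_{-t}, S_x b_0⟩_{L²(μ)}`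
  (unitarity of the Koopman group), and for the shift orbit of `b_0` the upper frame bound
  `Σ_x |⟨f, S_x b_0⟩|² ≤ (Σ_n |⟨b_0, b_n⟩_μ|) ‖f‖²` (Schur test) holds as soon as the STATIC
  correlation `n ↦ ⟨b_0 b_n⟩_μ` is absolutely summable: trivial for `b = p` (Maxwellian momenta,
  `⟨p_0 p_n⟩ = T δ_{n0}`), transfer-operator clustering for `b = q`.  TRUE ALSO IN THE HARMONIC CORNER
  (it is the Parseval structure `Ĝ(·,t) ∈ L²(𝕋)` the route header invokes); it owns the short times.
* `stub_intensityTailDecay` (DYNAMIC INPUT — dephasing proper; the hard, open stub): there are `t₀` and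
  `h ∈ L¹((t₀,∞))` with `Σ_{x∈s} F(x,t) ≤ h(t)` for all `t > t₀` and finite `s` — the late-time
  k-integrated one-phonon intensity `K(t) = Σ_ab ∫ |Ĝ_ab(k,t)|² dk` has an integrable majorant.  This is
  the form one-phonon kinetic theory delivers (`Ĝ(k,t) ≈ e^{-Γ(k)|t|}` on the kinetic scale,
  LukkarinenSpohn2010 Thm 2.4; `Γ(k) > 0` at every `k` in `d = 1` for the pinned quartic chain, refuter
  CruxAttack.md on this item) and the form a Mourre / Fermi-golden-rule estimate on the flip-odd
  one-particle sector would give; FALSE at `lam = β = 0` (`K(t)` does not decay: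
  `Literature.Barriers.AtomisticToContinuum.HarmonicChainBallisticFlux`), exactly the crux's recorded
  failure mode, now isolated from the statics.
* COMPOSITION `OnePhononL2Decay_of` (kernel-checked, sorry-free outside the stubs): infrastructure ⇒
  `(D, μ_T)` with (i); stub 1 ⇒ (ii) + continuity; the sorry-free helper
  `integrableOn_Ioi_and_summable_of_envelope` (Tonelli on `ℤ × (0,∞)` through bounded partial sums:
  split `(0,∞) = (0,t₁] ∪ (t₁,∞)`, `t₁ = max t₀ 0`; on `(0,t₁]` continuity gives per-site integrability
  and stub 2 bounds the partial sums by `K₀`; on `(t₁,∞)` stub 3 dominates by `h`;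
  `summable_of_sum_le`) ⇒ (iii) + (iv).

Hardest stub: `stub_intensityTailDecay` (open problem: no decay theorem for equilibrium time
correlations of a deterministic anharmonic lattice at fixed coupling, LukkarinenSpohn2010 p. 4; sources
as on the crux: LukkarinenSpohn2010, AokiLukkarinenSpohn2006, Lukkarinen2016, HuveneersLukkarinen2020).
Why the cut is not a costume: stub 3 speaks only of the late-time partial sums of the canonical
intensity (no ∃-frame, no per-site time-integrability, nothing on `(0,t₀]`), stub 2 is a static /
unitarity statement true for the harmonic chain where the crux is false, stub 1 is regularity; the
crux follows only through the infrastructure theorem + the Tonelli helper.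
BC3 audit (planner folder `bc/`, 2026-08-17): `lean check --json` of this file rc 0, errors [], sorries
3 = stubs (the only `declaration uses sorry` warnings are the three stub declarations; the helper is
closed); probes `stub → OnePhononL2Decay` and `stub → FouriersLaw` by
`first | exact? | simpa | simpa [S] | (unfold S; simpa) | aesop | (unfold S; aesop)` (maxHeartbeats
400000, same imports + the sub Statement) FAIL for all three stubs (rc 1, unsolved goals, aesop
exhaustive search failed; `exact?` alone: "could not close the goal" on all 6 goals).
Disproof used: none on file (`ledger crux ls stmt-AtomisticToContinuum-12157`: no `Disproof.lean`, no
`Negative/` lemma, 2026-08-17); refuter evidence CruxAttack.md (survives; `0 < γ` unnecessary; WLOG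
`T = 1` by scaling) respected — no stub uses `γ` beyond the carrier theorem's signature.
-/

noncomputable section

open MeasureTheory Filter Set Topology

namespace Summit.AtomisticToContinuum.FouriersLaw.Cruxes.OnePhononL2Decay

namespace Birth

/-- **stub 1 — `stub_onePhononRegularity` (carrier regularity; provable now).**  On the canonical
class (`D.carrier = bmGood`, `μ` a shift-invariant DLR Gibbs state at `T > 0` preserved by `D`) the
one-phonon integrands `a_0 · (b_x ∘ φ_t)`, `a, b ∈ {q, p}`, are `μ`-integrable and the one-phonon
block `t ↦ G_ab(x,t) = ∫ a_0 · (b_x ∘ φ_t) dμ` is continuous in time (4th moments of the superstable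
state + measure preservation + continuity of orbits; `InfiniteChainTwoPointContinuity`). -/
theorem stub_onePhononRegularity :
    ∀ ω₂ lam β γ : ℝ, 0 < ω₂ → 0 < lam → 0 < β → 0 < γ → ∀ T : ℝ, 0 < T →
    ∀ (D : Literature.MathematicalPhysics.KineticTheory.HeatConduction.InfiniteChainDynamics
        (Literature.MathematicalPhysics.KineticTheory.HeatConduction.pinnedChain ω₂ lam β γ))
      (μ : MeasureTheory.Measure Literature.MathematicalPhysics.KineticTheory.HeatConduction.ChainConfig),
      D.carrier = (Literature.MathematicalPhysics.KineticTheory.HeatConduction.pinnedChain ω₂ lam β γ).bmGood →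
      (Literature.MathematicalPhysics.KineticTheory.HeatConduction.pinnedChain ω₂ lam β γ).IsChainGibbsMeasure T μ →
      Literature.MathematicalPhysics.KineticTheory.HeatConduction.IsShiftInvariant μ →
      D.PreservesMeasure μ →
    (∀ (t : ℝ) (x : ℤ),
        MeasureTheory.Integrable (fun σ => (σ 0).1 * (D.flow t σ x).1) μ ∧
        MeasureTheory.Integrable (fun σ => (σ 0).1 * (D.flow t σ x).2) μ ∧
        MeasureTheory.Integrable (fun σ => (σ 0).2 * (D.flow t σ x).1) μ ∧
        MeasureTheory.Integrable (fun σ => (σ 0).2 * (D.flow t σ x).2) μ) ∧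
    (∀ x : ℤ,
        Continuous (fun t : ℝ => MeasureTheory.integral μ (fun σ => (σ 0).1 * (D.flow t σ x).1)) ∧
        Continuous (fun t : ℝ => MeasureTheory.integral μ (fun σ => (σ 0).1 * (D.flow t σ x).2)) ∧
        Continuous (fun t : ℝ => MeasureTheory.integral μ (fun σ => (σ 0).2 * (D.flow t σ x).1)) ∧
        Continuous (fun t : ℝ => MeasureTheory.integral μ (fun σ => (σ 0).2 * (D.flow t σ x).2))) := by
  sorry

/-- **stub 2 — `stub_uniformIntensityBound` (static clustering × Koopman unitarity; provable with
work).**  On the canonical class the finite partial sums of the one-phonon intensity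
`F(x,t) = Σ_ab G_ab(x,t)²` are bounded uniformly in time: `Σ_{x∈s} F(x,t) ≤ K₀` for all `t` and all
finite `s ⊂ ℤ` (upper frame bound of the shift orbit of `q_0`, `p_0` in `L²(μ)` from absolutely
summable static correlations, applied to `a_0 ∘ φ_{-t}`; holds in the harmonic corner too). -/
theorem stub_uniformIntensityBound :
    ∀ ω₂ lam β γ : ℝ, 0 < ω₂ → 0 < lam → 0 < β → 0 < γ → ∀ T : ℝ, 0 < T →
    ∀ (D : Literature.MathematicalPhysics.KineticTheory.HeatConduction.InfiniteChainDynamics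
        (Literature.MathematicalPhysics.KineticTheory.HeatConduction.pinnedChain ω₂ lam β γ))
      (μ : MeasureTheory.Measure Literature.MathematicalPhysics.KineticTheory.HeatConduction.ChainConfig),
      D.carrier = (Literature.MathematicalPhysics.KineticTheory.HeatConduction.pinnedChain ω₂ lam β γ).bmGood →
      (Literature.MathematicalPhysics.KineticTheory.HeatConduction.pinnedChain ω₂ lam β γ).IsChainGibbsMeasure T μ →
      Literature.MathematicalPhysics.KineticTheory.HeatConduction.IsShiftInvariant μ →
      D.PreservesMeasure μ →
    ∃ K₀ : ℝ, ∀ (t : ℝ) (s : Finset ℤ),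
      ∑ x ∈ s, ((MeasureTheory.integral μ (fun σ => (σ 0).1 * (D.flow t σ x).1)) ^ 2 +
        (MeasureTheory.integral μ (fun σ => (σ 0).1 * (D.flow t σ x).2)) ^ 2 +
        (MeasureTheory.integral μ (fun σ => (σ 0).2 * (D.flow t σ x).1)) ^ 2 +
        (MeasureTheory.integral μ (fun σ => (σ 0).2 * (D.flow t σ x).2)) ^ 2) ≤ K₀ := by
  sorry

/-- **stub 3 — `stub_intensityTailDecay` (DYNAMIC: dephasing of the one-phonon block; the hard,
open stub).**  On the canonical class the late-time k-integrated one-phonon intensity has an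
integrable majorant: there are `t₀` and `h` integrable on `(t₀, ∞)` with `Σ_{x∈s} F(x,t) ≤ h t` for all
`t > t₀` and all finite `s ⊂ ℤ` (`K(t) = Σ_ab ∫ |Ĝ_ab(k,t)|² dk ≤ h(t)`, e.g. `e^{-2Γ_min t}`-type bounds
of one-phonon kinetic theory; false at `lam = β = 0`). -/
theorem stub_intensityTailDecay :
    ∀ ω₂ lam β γ : ℝ, 0 < ω₂ → 0 < lam → 0 < β → 0 < γ → ∀ T : ℝ, 0 < T →
    ∀ (D : Literature.MathematicalPhysics.KineticTheory.HeatConduction.InfiniteChainDynamics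
        (Literature.MathematicalPhysics.KineticTheory.HeatConduction.pinnedChain ω₂ lam β γ))
      (μ : MeasureTheory.Measure Literature.MathematicalPhysics.KineticTheory.HeatConduction.ChainConfig),
      D.carrier = (Literature.MathematicalPhysics.KineticTheory.HeatConduction.pinnedChain ω₂ lam β γ).bmGood →
      (Literature.MathematicalPhysics.KineticTheory.HeatConduction.pinnedChain ω₂ lam β γ).IsChainGibbsMeasure T μ →
      Literature.MathematicalPhysics.KineticTheory.HeatConduction.IsShiftInvariant μ →
      D.PreservesMeasure μ →
    ∃ (t₀ : ℝ) (h : ℝ → ℝ), MeasureTheory.IntegrableOn h (Set.Ioi t₀) MeasureTheory.volume ∧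
      ∀ t : ℝ, t₀ < t → ∀ s : Finset ℤ,
        ∑ x ∈ s, ((MeasureTheory.integral μ (fun σ => (σ 0).1 * (D.flow t σ x).1)) ^ 2 +
          (MeasureTheory.integral μ (fun σ => (σ 0).1 * (D.flow t σ x).2)) ^ 2 +
          (MeasureTheory.integral μ (fun σ => (σ 0).2 * (D.flow t σ x).1)) ^ 2 +
          (MeasureTheory.integral μ (fun σ => (σ 0).2 * (D.flow t σ x).2)) ^ 2) ≤ h t := by
  sorry

/-- **Tonelli helper (sorry-free, abstract).**  If every `F x : ℝ → ℝ` is non-negative and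
continuous, the finite partial sums `Σ_{x∈s} F x t` are bounded by `K₀` at every `t` and by `h t`
for `t > t₀` with `h` integrable on `(t₀,∞)`, then every `F x` is integrable on `(0,∞)` and
`x ↦ ∫_{(0,∞)} F x` is summable (bounded partial sums of non-negative reals). -/
theorem integrableOn_Ioi_and_summable_of_envelope (F : ℤ → ℝ → ℝ) (hF0 : ∀ x t, 0 ≤ F x t)
    (hFc : ∀ x, Continuous (F x)) (K₀ : ℝ) (hK : ∀ (t : ℝ) (s : Finset ℤ), ∑ x ∈ s, F x t ≤ K₀)
    (t₀ : ℝ) (h : ℝ → ℝ) (hh : IntegrableOn h (Ioi t₀))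
    (htail : ∀ t : ℝ, t₀ < t → ∀ s : Finset ℤ, ∑ x ∈ s, F x t ≤ h t) :
    (∀ x, IntegrableOn (F x) (Ioi 0)) ∧ Summable (fun x => ∫ t in Ioi 0, F x t) := by
  -- WLOG `t₀ ≥ 0`
  set t₁ : ℝ := max t₀ 0 with ht₁def
  have ht₁ : (0 : ℝ) ≤ t₁ := le_max_right _ _
  have ht₀₁ : t₀ ≤ t₁ := le_max_left _ _
  have hh₁ : IntegrableOn h (Ioi t₁) := hh.mono_set (Ioi_subset_Ioi ht₀₁)
  have htail₁ : ∀ t : ℝ, t₁ < t → ∀ s : Finset ℤ, ∑ x ∈ s, F x t ≤ h t :=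
    fun t ht s => htail t (lt_of_le_of_lt ht₀₁ ht) s
  -- single-site consequence of the tail bound
  have hFh : ∀ (x : ℤ) (t : ℝ), t₁ < t → F x t ≤ h t := fun x t ht => by
    simpa using htail₁ t ht {x}
  -- the half-line as a disjoint union
  have hsplit : Ioi (0 : ℝ) = Ioc 0 t₁ ∪ Ioi t₁ := (Ioc_union_Ioi_eq_Ioi ht₁).symm
  -- (iii) per-site integrability: continuity on `(0, t₁]`, domination by `h` on `(t₁, ∞)`
  have hloc : ∀ x, IntegrableOn (F x) (Ioc 0 t₁) := fun x => (hFc x).integrableOn_Ioc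
  have htl : ∀ x, IntegrableOn (F x) (Ioi t₁) := by
    intro x
    refine Integrable.mono' hh₁ (hFc x).aestronglyMeasurable ?_
    filter_upwards [ae_restrict_mem measurableSet_Ioi] with t ht
    rw [Real.norm_of_nonneg (hF0 x t)]
    exact hFh x t ht
  have hint : ∀ x, IntegrableOn (F x) (Ioi 0) := fun x => by
    rw [hsplit]
    exact (hloc x).union (htl x)
  refine ⟨hint, ?_⟩
  -- (iv) summability: partial sums of `x ↦ ∫ F x` are bounded
  have hB : ∀ s : Finset ℤ,
      ∑ x ∈ s, ∫ t in Ioi (0 : ℝ), F x t ≤ (∫ t in Ioc (0 : ℝ) t₁, K₀) + ∫ t in Ioi t₁, h t := by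
    intro s
    rw [← integral_finsetSum s (fun x _ => hint x)]
    have hΦloc : IntegrableOn (fun t => ∑ x ∈ s, F x t) (Ioc 0 t₁) :=
      integrable_finsetSum s (fun x _ => hloc x)
    have hΦtl : IntegrableOn (fun t => ∑ x ∈ s, F x t) (Ioi t₁) :=
      integrable_finsetSum s (fun x _ => htl x)
    have hKloc : IntegrableOn (fun _ : ℝ => K₀) (Ioc 0 t₁) := continuous_const.integrableOn_Ioc
    rw [hsplit, setIntegral_union (Ioc_disjoint_Ioi le_rfl) measurableSet_Ioi hΦloc hΦtl]
    refine add_le_add ?_ ?_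
    · exact setIntegral_mono_on hΦloc hKloc measurableSet_Ioc (fun t _ => hK t s)
    · exact setIntegral_mono_on hΦtl hh₁ measurableSet_Ioi (fun t ht => htail₁ t ht s)
  refine summable_of_sum_le (fun x => ?_) hB
  exact setIntegral_nonneg measurableSet_Ioi (fun t _ => hF0 x t)

/-- **Skeleton theorem — the crux `TangentFlowDephasing.OnePhononL2Decay` BY NAME** from the three
stubs and the PROVED canonical carrier (`stub_heatableInfrastructure`, crux 12597's landed
infrastructure: BM dynamics on `bmGood` + the shift-invariant DLR state + absolutely convergent
current correlations). -/
theorem OnePhononL2Decay_of :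
    Summit.AtomisticToContinuum.FouriersLaw.Theses.TangentFlowDephasing.OnePhononL2Decay := by
  intro ω₂ lam β γ hω hl hβ hγ T hT
  -- (i) the canonical carrier, PROVED infrastructure
  obtain ⟨D, hcar, hfam⟩ :=
    Summit.AtomisticToContinuum.FouriersLaw.Theorems.GreenKuboContinuation.HeatedMeasureThermalExponent.stub_heatableInfrastructure
      ω₂ lam β γ hω hl hβ hγ
  obtain ⟨μ, hG, hS, hP, hAC, -, -⟩ := hfam T hT
  -- stub 1: integrable integrands (ii) and continuity in time
  obtain ⟨hInt, hCont⟩ :=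
    stub_onePhononRegularity ω₂ lam β γ hω hl hβ hγ T hT D μ hcar hG hS hP
  -- stub 2: uniform bound on the partial sums of the intensity
  obtain ⟨K₀, hK₀⟩ :=
    stub_uniformIntensityBound ω₂ lam β γ hω hl hβ hγ T hT D μ hcar hG hS hP
  -- stub 3: integrable majorant of the late-time intensity
  obtain ⟨t₀, h, hh, htail⟩ :=
    stub_intensityTailDecay ω₂ lam β γ hω hl hβ hγ T hT D μ hcar hG hS hP
  -- Tonelli helper on the intensity `F x t = Σ_ab G_ab(x,t)²`
  have hmain := integrableOn_Ioi_and_summable_of_envelope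
    (fun (x : ℤ) (t : ℝ) =>
      (MeasureTheory.integral μ (fun σ => (σ 0).1 * (D.flow t σ x).1)) ^ 2 +
        (MeasureTheory.integral μ (fun σ => (σ 0).1 * (D.flow t σ x).2)) ^ 2 +
        (MeasureTheory.integral μ (fun σ => (σ 0).2 * (D.flow t σ x).1)) ^ 2 +
        (MeasureTheory.integral μ (fun σ => (σ 0).2 * (D.flow t σ x).2)) ^ 2)
    (fun x t => by positivity)
    (fun x => by
      obtain ⟨h1, h2, h3, h4⟩ := hCont x
      exact (((h1.pow 2).add (h2.pow 2)).add (h3.pow 2)).add (h4.pow 2))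
    K₀ hK₀ t₀ h hh htail
  exact ⟨μ, hG, hS, D, hP, hAC, hInt, hmain.1, hmain.2⟩

end Birth

end Summit.AtomisticToContinuum.FouriersLaw.Cruxes.OnePhononL2Decay

end
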